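import Mathlib.RepresentationTheory.Homological.ContCohomology.Basic
import Mathlib.RepresentationTheory.Homological.ContCohomology.Functoriality
import Mathlib.Topology.Instances.Matrix
import Literature.NumberTheory.GaloisRepresentations.GaloisRep
import Literature.NumberTheory.GaloisRepresentations.LocalGlobalCohomology
import Literature.NumberTheory.GaloisRepresentations.ModPGaloisRep
import HarnessLib

/-!
# The global trianguline deformation space `X^glob_tri(ρ̄, S)` (points and tangent spaces)

Requested notion `GlobalTriangulineSpace` (route `Langlands/NewtonPatching`, crux
`DualTriangulineSelmerVanishing`).  For a number field `K`, a finite set of finite places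
`S ⊇ S_p`, and `ρ̄ : Γ_K → GL_n(k)` absolutely irreducible, Breuil–Hellmann–Schraen consider

* the rigid generic fibre `𝔛_{ρ̄,S} := (Spf R_{ρ̄,S})^rig` of the universal deformation ring of
  `ρ̄` unramified outside `S` [cite: BreuilHellmannSchraen2017Smoothness, §3.1] (there with an
  extra polarisation condition), whose `L'`-points are the lifts `ρ : Γ_K → GL_n(L')` of `ρ̄`
  unramified outside `S` up to conjugation;
* for `v ∣ p` the framed local deformation space `𝔛^□_{ρ̄_v} := (Spf R^□_{ρ̄_v})^rig`, the
  character variety `𝒯ⁿ` of `(K_vˣ)ⁿ`, and the **trianguline variety**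
  `X^□_tri(ρ̄_v) ⊆ 𝔛^□_{ρ̄_v} × 𝒯ⁿ`, the Zariski closure of
  `U^□_tri(ρ̄_v)^reg = {(r, δ) : δ ∈ 𝒯ⁿ_reg, r trianguline of parameter δ}`
  [cite: BreuilHellmannSchraen2017Trianguline, Déf. 2.4], equidimensional of dimension
  `n² + [K_v:ℚ_p] n(n+1)/2` with `U^□_tri(ρ̄_v)^reg` smooth, Zariski-open and Zariski-dense
  [cite: BreuilHellmannSchraen2017Trianguline, Th. 2.6];
* the morphism `𝔛_{ρ̄,S} × 𝒯ⁿ_p → 𝔛^□_{ρ̄_p} × 𝒯ⁿ_p`, `(ρ, δ) ↦ ((ρ|_{Γ_{K_v}})_v, δ)`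
  [cite: BreuilHellmannSchraen2017Smoothness, §3.1, (3.3)–(3.4)].

The **global trianguline space** of the route is the fibre product
`X^glob_tri(ρ̄, S) := 𝔛_{ρ̄,S} ×_{𝔛^□_{ρ̄_p}} ∏_{v ∣ p} X^□_tri(ρ̄_v)`, i.e. the preimage of
`∏_v X^□_tri(ρ̄_v)` under that morphism: pairs `(ρ, δ)` with `ρ` a lift of `ρ̄` unramified
outside `S` and `(ρ|_{Γ_{K_v}}, δ_v) ∈ X^□_tri(ρ̄_v)` for every `v ∣ p`.

## What is constructed here, and what is a parameter

Mathlib has no rigid-analytic geometry, no `(φ, Γ)`-modules over the Robba ring and no `D_rig`,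
so neither the rigid space `X^□_tri(ρ̄_v)` nor even its set of points (a Zariski *closure*) can be
written down today; the local factor is the separate request `TriangulineAt`.  Following the
requester's "functor-of-points / tangent spaces as `H¹`" fallback, this file constructs the
GLOBAL side with honest bodies at two levels, both PARAMETRIC in the local input at the places of a
set `Sp` (intended: `Sp = {v ∣ p}`, local input = the trianguline variety):

1. **Points** (`section Points`, `section Global`).  For a topological coefficient field `C`
   (e.g. `C = ℚ̄_p = PadicAlgCl p` or a finite `E/ℚ_p`), a valuation subring `O ⊆ C` with a ring
   map `θ : O → k`, and local loci
   `Xtri v ⊆ (Γ_{K_v} →ₜ* GL_n(C)) × 𝒯ⁿ(C)` (`Literature.NumberTheory.GaloisRepresentations.LocalParameterLoci`):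
   * `GlobalTriangulineSpace.FramedPoint ρ̄ S O θ Xtri`: a continuous `ρ : Γ_K →ₜ* GL_n(C)` which is
     a *framed* `O`-integral lift of `ρ̄` (`FramedRep.IsFramedLift`: `ρ = ρ₀ ⊗_O C` with
     `θ ∘ ρ₀ = ρ̄` on the nose — a `C`-point of the framed space `𝔛^□_{ρ̄}`), unramified at every
     `v ∉ S` (`FramedGaloisRep.IsUnramifiedAt` of the tree), together with parameters
     `δ_v ∈ 𝒯ⁿ(C)` (`CharacterTuple`: `n`-tuples of continuous characters `K_vˣ → Cˣ`) such that
     `(ρ|_{Γ_{K_v}}, δ_v) ∈ Xtri v` for all `v ∈ Sp` (`FramedGaloisRep.toLocal` of the tree);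
   * `GlobalTriangulineSpace.Point`: the quotient by change of framing (`GL_n(C)`-conjugation,
     `FramedRep.conj`), i.e. the `C`-points of `X^glob_tri(ρ̄, S)`;
   * the two projections `Point.toDeformation : X^glob_tri → 𝔛_{ρ̄,S}(C)`
     (`DeformationSpace.Point`) and `FramedPoint.toLocal v : X^glob,□ → Xtri v`, the parameter map
     `Point.param`, and the fibre-product facts `Point.toDeformation_param_injective`
     (`X^glob_tri ↪ 𝔛_{ρ̄,S} × 𝒯ⁿ_p`) and `FramedPoint.mem_local`.
2. **Tangent spaces** (`section GaloisAdjoint`).  For `ρ : Γ_K →ₜ* GL_n(A)` over a topological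
   ring `A` (the representation `ρ_x` at a point `x`, `A = k(x)`):
   * the adjoint representation `FramedRep.adjoint ρ = ad ρ` on `M_n(A)` (continuity proved) and
     its continuous cohomology `ContinuousRep.H (ad ρ) q = H^q_cont(Γ_K, ad ρ)` (Mathlib
     `continuousCohomology`), restriction to `Γ_L` for `L/K` (`FramedGaloisRep.adjointRes`), to
     `Γ_{K_v}` (`adjointLoc`) and to inertia fields;
   * `FramedGaloisRep.adjointHUnramifiedOutside S ρ q = H^q_S(Γ_K, ad ρ)`, the classes unramified
     outside `S`; for `q = 1` and `ρ` unramified outside `S` this is `H¹(G_{K,S}, ad ρ)`, the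
     tangent space `T_ρ 𝔛_{ρ̄,S}` of the deformation problem "unramified outside `S`"
     [cite: Mazur1997Deformation, §21, §26] (inflation `H¹(G_{K,S}, –) → H¹(Γ_K, –)` is injective
     and a class of `Γ_K` restricting to zero on every inertia group outside `S` is inflated from
     `G_{K,S} = Gal(K_S/K)`, `K_S` being the maximal extension of `K` unramified outside `S`);
   * given local tangent conditions `L v ⊆ H¹(Γ_{K_v}, ad ρ|_{Γ_{K_v}})`, `v ∈ Sp` (intended:
     the image of `T_{x_v} U^□_tri(ρ̄_v)`, i.e. the trianguline first-order deformations), the map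
     `FramedGaloisRep.tangentObstructionMap S ρ L : H¹_S(Γ_K, ad ρ) → Π_{v ∈ Sp} H¹(Γ_{K_v}, ad ρ_v) ⧸ L_v`,
     the tangent space `FramedGaloisRep.tangentSpaceWith S ρ L` (its kernel:
     `tangentObstructionMap_eq_zero_iff`, the exact sequence
     `0 → T_x X^glob_tri → H¹(G_{K,S}, ad ρ_x) → ⊕_{v∣p} H¹(K_v, ad ρ_x)/L_v` of the request), and
     the predicate `FramedGaloisRep.TangentObstructionSurjective S ρ L` (surjectivity of that map).
     By the Poitou–Tate / Greenberg–Wiles sequence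
     `0 → T_x → H¹(G_{K,S}, ad ρ) → ⊕_v H¹(K_v, ad ρ)/L_v → H¹_{L^⊥}(G_{K,S}, ad ρ(1))^∨ → H²(G_{K,S}, ad ρ)`
     surjectivity is IMPLIED by the vanishing of the dual Selmer group `H¹_{L^⊥}(G_{K,S}, ad ρ(1))`
     (crux `DualTriangulineSelmerVanishing`; the dual Selmer group itself is the separate request
     `DualTriangulineSelmer`) and is equivalent to it iff `H¹_{L^⊥}(ad ρ(1))^∨ → H²(G_{K,S}, ad ρ)`
     is injective; so `TangentObstructionSurjective` is the consequence-form of the crux, the one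
     that yields `dim T_x = h¹(G_{K,S}, ad ρ) − Σ_{v ∈ Sp} (h¹(K_v, ad ρ) − dim L_v)`).

   Dictionary with BHS at a point `x = (ρ, δ)` with every `x_v ∈ U^□_tri(ρ̄_v)^reg`: the completed
   local ring of `𝔛^□_{ρ̄_v}` at `ρ_v` is the framed deformation ring `R^□_{ρ_v}` of `ρ_v`
   [cite: BreuilHellmannSchraen2017Trianguline, §2.2, proof of Th. 2.6], so
   `T_{ρ_v} 𝔛^□_{ρ̄_v} = Z¹_cont(Γ_{K_v}, ad ρ_v)` [cite: Mazur1997Deformation, §21]; for `δ_v`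
   regular the triangulation with parameter `δ_v` is unique and the trianguline deformation
   functor is a subfunctor of the deformation functor [cite: BellaicheChenevier2009, §2.3],
   [cite: BreuilHellmannSchraen2017Trianguline, proof of Th. 2.6 (fibres of `π_ρ̄` are `𝔾_mⁿ`)],
   so `T_{x_v} U^□_tri → T_{ρ_v} 𝔛^□_{ρ̄_v}` is injective; its image contains the coboundaries, and
   `L_v` is its image in `H¹`.  Dividing the framed global tangent space by `B¹(Γ_K, ad ρ)` gives
   `T_x X^glob_tri = ker (tangentObstructionMap)`; this is the "global deformation functor with a
   local trianguline condition at `p`" of [cite: BellaicheChenevier2009, §7.6.1, Def. 7.6.2]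
   (there with an extra condition at `v ∈ S`, `v ∤ p`, which BHS and the route do not impose) and
   an instance of Mazur's global Galois deformation problems with local conditions
   [cite: Mazur1997Deformation, §26].

Nothing in this file asserts anything about the trianguline variety: all statements about it
(existence, Th. 2.6, the description of `L_v`) belong to the local request and enter the crux as
hypotheses on the parameters `Xtri` / `L`.

## Mathlib / Literature declarations used rather than redefined

`continuousCohomology`, `ContinuousCohomology.map`, `TopRep.ofHom`, `Matrix.GeneralLinearGroup.map`,
`ContinuousMonoidHom` (`→ₜ*`), `ValuationSubring.subtype`, `Submodule.mkQ`, `LinearMap.pi`;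
from the tree: `FramedRep`, `FramedRep.conj`, `FramedGaloisRep`, `FramedGaloisRep.toLocal`,
`FramedGaloisRep.restrictField`, `FramedGaloisRep.IsUnramifiedAt`, `ModPGaloisRep`,
`absGaloisRestrict`, `absInertiaField`, `HeightOneSpectrum.primesAbove`, `ContinuousRep`,
`ContinuousRep.toTopRep`, `ContinuousRep.restrict`.  (`lean search` for `trianguline`, `Robba`,
`deformationFunctor`, `adjoint` representation: no hits in Mathlib or the tree.)

## Design notes

* Universes: continuous cohomology forces the coefficient module `M_n(A)` into the universe of
  `Γ_K`, so `K A : Type u` in `section GaloisAdjoint`; the points layer is universe polymorphic.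
* The local input is a bare family of sets / submodules: the fibre-product construction needs no
  axiom on it.  BHS's `X^□_tri(ρ̄_v)` is stable under residually trivial change of framing, which
  is what makes `Point` independent of the framed representative; here `Point` is *defined* as the
  quotient of the framed fibre product, so no such hypothesis is needed either.
* "Lift of `ρ̄`" is the framed, integral notion (`IsFramedLift`), matching points of `Spf` of the
  framed deformation ring; the unframed space is the quotient by `FramedRep.conj`.
-/

noncomputable section

open scoped NumberField
open Field IsDedekindDomain CategoryTheory

namespace Literature.NumberTheory.GaloisRepresentations

universe u v w

/-! ### The adjoint representation `ad ρ` -/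

section Adjoint

variable {G : Type u} [Group G] [TopologicalSpace G] {A : Type v} [CommRing A] {n : ℕ}

/-- The `A`-linear map `X ↦ P X P⁻¹` on `n × n` matrices, for `P ∈ GL_n(A)`. [folklore] -/
def glConjLinear (P : GL (Fin n) A) :
    Matrix (Fin n) (Fin n) A →ₗ[A] Matrix (Fin n) (Fin n) A where
  toFun X := (P : Matrix (Fin n) (Fin n) A) * X * ((P⁻¹ : GL (Fin n) A) : Matrix (Fin n) (Fin n) A)
  map_add' X Y := by simp [mul_add, add_mul]
  map_smul' a X := by simp

/-- Unfolding lemma for `glConjLinear`. [folklore] -/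
@[simp] lemma glConjLinear_apply (P : GL (Fin n) A)
    (X : Matrix (Fin n) (Fin n) A) :
    glConjLinear P X =
      (P : Matrix (Fin n) (Fin n) A) * X * ((P⁻¹ : GL (Fin n) A) : Matrix (Fin n) (Fin n) A) :=
  rfl

variable [TopologicalSpace A] [IsTopologicalRing A]

/-- The **adjoint representation** `ad ρ` of a framed continuous representation
`ρ : G →ₜ* GL_n(A)`: `G` acts on `M_n(A) = End(Aⁿ)` by `X ↦ ρ(g) X ρ(g)⁻¹`; the action map is
jointly continuous (matrix multiplication and `g ↦ ρ(g)^{±1}` are continuous).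
[cite: Mazur1997Deformation, §21] -/
def FramedRep.adjoint (ρ : FramedRep G A n) : ContinuousRep G A (Matrix (Fin n) (Fin n) A) where
  toRepresentation :=
    { toFun := fun g => glConjLinear (ρ g)
      map_one' := by
        refine LinearMap.ext fun X => ?_
        simp
      map_mul' := fun g h => by
        refine LinearMap.ext fun X => ?_
        simp [mul_assoc] }
  continuous_smul := by
    show Continuous fun p : G × Matrix (Fin n) (Fin n) A =>
      ((ρ p.1 : GL (Fin n) A) : Matrix (Fin n) (Fin n) A) * p.2 *
        (((ρ p.1)⁻¹ : GL (Fin n) A) : Matrix (Fin n) (Fin n) A)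
    have h1 : Continuous fun p : G × Matrix (Fin n) (Fin n) A =>
        ((ρ p.1 : GL (Fin n) A) : Matrix (Fin n) (Fin n) A) :=
      Units.continuous_val.comp ((map_continuous ρ).comp continuous_fst)
    have h2 : Continuous fun p : G × Matrix (Fin n) (Fin n) A =>
        (((ρ p.1)⁻¹ : GL (Fin n) A) : Matrix (Fin n) (Fin n) A) :=
      Units.continuous_coe_inv.comp ((map_continuous ρ).comp continuous_fst)
    exact (h1.mul continuous_snd).mul h2

/-- Unfolding lemma for `FramedRep.adjoint`. [folklore] -/
@[simp] lemma FramedRep.adjoint_apply_apply (ρ : FramedRep G A n) (g : G)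
    (X : Matrix (Fin n) (Fin n) A) :
    ρ.adjoint g X = ((ρ g : GL (Fin n) A) : Matrix (Fin n) (Fin n) A) * X *
        (((ρ g)⁻¹ : GL (Fin n) A) : Matrix (Fin n) (Fin n) A) := rfl

end Adjoint

/-! ### Continuous cohomology with topological coefficients -/

section Cohomology

variable {G : Type u} [Group G] [TopologicalSpace G] [IsTopologicalGroup G]
  {A : Type u} [CommRing A] [TopologicalSpace A] [IsTopologicalRing A]
  {M : Type u} [AddCommGroup M] [Module A M] [TopologicalSpace M] [IsTopologicalAddGroup M]
  [ContinuousSMul A M]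

/-- `H^q_cont(G, M)` for a continuous representation `ρ` of `G` on a topological `A`-module `M`
(continuous homogeneous cochains): the carrier of Mathlib's
`continuousCohomology q ρ.toTopRep : TopModuleCat A`.  Universe restriction as in
`Literature.NumberTheory.GaloisRepresentations.galoisCohomology`: `G`, `A`, `M` in one universe.
[cite: SerreGaloisCohomology1997, Ch. I §2.2] -/
def ContinuousRep.H (ρ : ContinuousRep G A M) (q : ℕ) : Type u :=
  (continuousCohomology q ρ.toTopRep : TopModuleCat A)

/-- `H^q_cont(G, M)` is an abelian group (transported from Mathlib's `TopModuleCat A` object).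
[folklore] -/
instance ContinuousRep.H.instAddCommGroup (ρ : ContinuousRep G A M) (q : ℕ) :
    AddCommGroup (ρ.H q) :=
  inferInstanceAs <| AddCommGroup (continuousCohomology q ρ.toTopRep : TopModuleCat A)

/-- `H^q_cont(G, M)` is an `A`-module (transported from Mathlib's `TopModuleCat A` object).
[folklore] -/
instance ContinuousRep.H.instModule (ρ : ContinuousRep G A M) (q : ℕ) : Module A (ρ.H q) :=
  inferInstanceAs <| Module A (continuousCohomology q ρ.toTopRep : TopModuleCat A)

variable {H' : Type u} [Group H'] [TopologicalSpace H'] [IsTopologicalGroup H']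

/-- Pull-back `H^q(G, M) → H^q(H', M)` along a continuous homomorphism `φ : H' →ₜ* G`, `H'`
acting through `φ` (`ContinuousRep.restrict`); Mathlib `ContinuousCohomology.map φ (𝟙)`.
[cite: SerreGaloisCohomology1997, Ch. I §2.4] -/
def ContinuousRep.Hpullback (ρ : ContinuousRep G A M) (φ : H' →ₜ* G) (q : ℕ) :
    ρ.H q →ₗ[A] (ρ.restrict φ).H q :=
  (ContinuousCohomology.map φ (X := ρ.toTopRep) (Y := (ρ.restrict φ).toTopRep)
    (TopRep.ofHom ⟨ContinuousLinearMap.id A M, fun _ => rfl⟩) q).hom.toLinearMap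

end Cohomology

/-! ### `H¹(Γ_K, ad ρ)`, unramified classes, local conditions and the tangent space -/

section GaloisAdjoint

variable {K : Type u} [Field K] {A : Type u} [CommRing A] [TopologicalSpace A]
  [IsTopologicalRing A] {n : ℕ}

/-- Restriction `H^q(Γ_K, ad ρ) → H^q(Γ_L, ad (ρ|_{Γ_L}))` for a field extension `L/K`, along
`absGaloisRestrict K L : Γ_L →ₜ* Γ_K` (the adjoint of the restricted representation
`ρ.restrictField L` *is* the restricted adjoint representation, definitionally).
[cite: SerreGaloisCohomology1997, Ch. I §2.4] -/
def FramedGaloisRep.adjointRes (ρ : FramedGaloisRep K A n) (L : Type u) [Field L] [Algebra K L]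
    (q : ℕ) : ρ.adjoint.H q →ₗ[A] (FramedRep.adjoint (ρ.restrictField L)).H q :=
  (ContinuousCohomology.map (absGaloisRestrict K L) (X := ρ.adjoint.toTopRep)
    (Y := (FramedRep.adjoint (ρ.restrictField L)).toTopRep)
    (TopRep.ofHom ⟨ContinuousLinearMap.id A (Matrix (Fin n) (Fin n) A), fun _ => rfl⟩)
      q).hom.toLinearMap

/-- A class `c ∈ H^q(Γ_K, ad ρ)` is **unramified at the finite place `v`** if its restriction to
the inertia field `K̄^{I_𝔓}` (i.e. to the inertia group `I_𝔓`) vanishes for every prime `𝔓 ∣ v` of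
`\bar ℤ_K` (same convention as `galoisCohomology.IsUnramifiedAt` for discrete modules).
[cite: MilneADT2006, Ch. I §4] -/
def FramedGaloisRep.adjointClassIsUnramifiedAt [NumberField K] {ρ : FramedGaloisRep K A n}
    {q : ℕ} (v : HeightOneSpectrum (𝓞 K)) (c : ρ.adjoint.H q) : Prop :=
  ∀ 𝔓 ∈ v.primesAbove, ρ.adjointRes (absInertiaField K 𝔓) q c = 0

/-- `H^q_S(Γ_K, ad ρ) ⊆ H^q(Γ_K, ad ρ)`: the classes unramified at every finite place `v ∉ S`
(an intersection of kernels of restriction maps, hence a submodule).  For `q = 1` and `ρ`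
unramified outside `S` this is `H¹(G_{K,S}, ad ρ)` (inflation is injective in degree one and a
class of `Γ_K` restricting to zero on all inertia groups outside `S` is inflated from
`G_{K,S} = Gal(K_S/K)`, `K_S` being the maximal extension unramified outside `S`), the tangent
space of the deformation problem "`ρ` unramified outside `S`".
[cite: Mazur1997Deformation, §21, §26], [cite: MilneADT2006, Ch. I §4] -/
def FramedGaloisRep.adjointHUnramifiedOutside [NumberField K] (S : Set (HeightOneSpectrum (𝓞 K)))
    (ρ : FramedGaloisRep K A n) (q : ℕ) : Submodule A (ρ.adjoint.H q) :=
  ⨅ (v : HeightOneSpectrum (𝓞 K)) (_ : v ∉ S) (𝔓 : Ideal (absIntegers (𝓞 K) K))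
    (_ : 𝔓 ∈ v.primesAbove), LinearMap.ker (ρ.adjointRes (absInertiaField K 𝔓) q)

/-- Membership in `H^q_S(Γ_K, ad ρ)`: unramified at every `v ∉ S`. [folklore] -/
lemma FramedGaloisRep.mem_adjointHUnramifiedOutside_iff [NumberField K]
    (S : Set (HeightOneSpectrum (𝓞 K))) (ρ : FramedGaloisRep K A n) (q : ℕ) (c : ρ.adjoint.H q) :
    c ∈ ρ.adjointHUnramifiedOutside S q ↔ ∀ v ∉ S, ρ.adjointClassIsUnramifiedAt v c := by
  simp only [FramedGaloisRep.adjointHUnramifiedOutside, Submodule.mem_iInf, LinearMap.mem_ker,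
    FramedGaloisRep.adjointClassIsUnramifiedAt]

variable [NumberField K]

/-- Localisation at a finite place: `loc_v : H^q(Γ_K, ad ρ) → H^q(Γ_{K_v}, ad (ρ|_{Γ_{K_v}}))`,
`K_v = v.adicCompletion K`, `ρ|_{Γ_{K_v}} = ρ.toLocal v`.
[cite: MilneADT2006, Ch. I §4] -/
abbrev FramedGaloisRep.adjointLoc (ρ : FramedGaloisRep K A n) (v : HeightOneSpectrum (𝓞 K))
    (q : ℕ) : ρ.adjoint.H q →ₗ[A] (FramedRep.adjoint (ρ.toLocal v)).H q :=
  ρ.adjointRes (v.adicCompletion K) q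

variable {Sp : Set (HeightOneSpectrum (𝓞 K))}

/-- The **tangent–obstruction map** at a point `ρ` of the global space with local tangent
conditions `L_v ⊆ H¹(Γ_{K_v}, ad ρ_v)` (`v ∈ Sp`):
`Φ : H¹_S(Γ_K, ad ρ) → Π_{v ∈ Sp} H¹(Γ_{K_v}, ad ρ_v) ⧸ L_v`, `c ↦ (loc_v c mod L_v)_v`.
With `L_v` the tangent space of `U^□_tri(ρ̄_v)^reg` at `x_v` this is the map of the request whose
kernel is `T_x X^glob_tri` and whose surjectivity is the dual-Selmer vanishing.
[cite: BellaicheChenevier2009, §7.6.1], [cite: Mazur1997Deformation, §26],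
[cite: BreuilHellmannSchraen2017Trianguline, Th. 2.6] -/
def FramedGaloisRep.tangentObstructionMap (S : Set (HeightOneSpectrum (𝓞 K)))
    (ρ : FramedGaloisRep K A n) (L : ∀ v : Sp, Submodule A ((FramedRep.adjoint (ρ.toLocal v.1)).H 1)) :
    ρ.adjointHUnramifiedOutside S 1 →ₗ[A] ∀ v : Sp, ((FramedRep.adjoint (ρ.toLocal v.1)).H 1 ⧸ L v) :=
  (LinearMap.pi fun v : Sp => (L v).mkQ ∘ₗ ρ.adjointLoc v.1 1) ∘ₗ
    (ρ.adjointHUnramifiedOutside S 1).subtype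

/-- Unfolding lemma for `tangentObstructionMap`: its `v`-component is `loc_v c mod L_v`.
[folklore] -/
@[simp] lemma FramedGaloisRep.tangentObstructionMap_apply (S : Set (HeightOneSpectrum (𝓞 K)))
    (ρ : FramedGaloisRep K A n) (L : ∀ v : Sp, Submodule A ((FramedRep.adjoint (ρ.toLocal v.1)).H 1))
    (c : ρ.adjointHUnramifiedOutside S 1) (v : Sp) :
    ρ.tangentObstructionMap S L c v = (L v).mkQ (ρ.adjointLoc v.1 1 c) := rfl

/-- The **tangent space** cut out by the local conditions:
`T = {c ∈ H¹_S(Γ_K, ad ρ) : loc_v c ∈ L_v for all v ∈ Sp}` (a Selmer-type subspace of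
`H¹(Γ_K, ad ρ)`); with `L_v = T_{x_v} U^□_tri` it is `T_x X^glob_tri(ρ̄, S)` (compare
`H¹_𝓡(E, ad V) := 𝔛_{V,𝓡}(L[ε])` of Bellaïche–Chenevier).
[cite: BellaicheChenevier2009, §7.6.1], [cite: Mazur1997Deformation, §21, §26] -/
def FramedGaloisRep.tangentSpaceWith (S : Set (HeightOneSpectrum (𝓞 K)))
    (ρ : FramedGaloisRep K A n) (L : ∀ v : Sp, Submodule A ((FramedRep.adjoint (ρ.toLocal v.1)).H 1)) :
    Submodule A (ρ.adjoint.H 1) :=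
  ρ.adjointHUnramifiedOutside S 1 ⊓ ⨅ v : Sp, (L v).comap (ρ.adjointLoc v.1 1)

/-- Membership in the tangent space: unramified outside `S` and locally in `L_v`. [folklore] -/
lemma FramedGaloisRep.mem_tangentSpaceWith_iff (S : Set (HeightOneSpectrum (𝓞 K)))
    (ρ : FramedGaloisRep K A n) (L : ∀ v : Sp, Submodule A ((FramedRep.adjoint (ρ.toLocal v.1)).H 1))
    (c : ρ.adjoint.H 1) :
    c ∈ ρ.tangentSpaceWith S L ↔
      c ∈ ρ.adjointHUnramifiedOutside S 1 ∧ ∀ v : Sp, ρ.adjointLoc v.1 1 c ∈ L v := by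
  simp only [FramedGaloisRep.tangentSpaceWith, Submodule.mem_inf, Submodule.mem_iInf,
    Submodule.mem_comap]

/-- Exactness of `0 → T → H¹_S(Γ_K, ad ρ) → Π_v H¹(Γ_{K_v}, ad ρ_v) ⧸ L_v`: a class is killed by
the tangent–obstruction map iff it lies in the tangent space. [folklore] -/
lemma FramedGaloisRep.tangentObstructionMap_eq_zero_iff (S : Set (HeightOneSpectrum (𝓞 K)))
    (ρ : FramedGaloisRep K A n) (L : ∀ v : Sp, Submodule A ((FramedRep.adjoint (ρ.toLocal v.1)).H 1))
    (c : ρ.adjointHUnramifiedOutside S 1) :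
    ρ.tangentObstructionMap S L c = 0 ↔ (c : ρ.adjoint.H 1) ∈ ρ.tangentSpaceWith S L := by
  rw [FramedGaloisRep.mem_tangentSpaceWith_iff]
  simp only [FramedGaloisRep.tangentObstructionMap, LinearMap.coe_comp, Function.comp_apply,
    Submodule.coe_subtype, funext_iff, LinearMap.pi_apply, Pi.zero_apply,
    Submodule.mkQ_apply, Submodule.Quotient.mk_eq_zero, SetLike.coe_mem, true_and]

/-- The kernel of the tangent–obstruction map is the tangent space (pulled back to `H¹_S`).
[folklore] -/
lemma FramedGaloisRep.ker_tangentObstructionMap (S : Set (HeightOneSpectrum (𝓞 K)))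
    (ρ : FramedGaloisRep K A n) (L : ∀ v : Sp, Submodule A ((FramedRep.adjoint (ρ.toLocal v.1)).H 1)) :
    LinearMap.ker (ρ.tangentObstructionMap S L) =
      (ρ.tangentSpaceWith S L).comap (ρ.adjointHUnramifiedOutside S 1).subtype := by
  ext c
  rw [LinearMap.mem_ker, FramedGaloisRep.tangentObstructionMap_eq_zero_iff, Submodule.mem_comap,
    Submodule.coe_subtype]

/-- The consequence-form of the crux in `H¹`: the tangent–obstruction map
`H¹_S(Γ_K, ad ρ) → Π_{v ∈ Sp} H¹(Γ_{K_v}, ad ρ_v) ⧸ L_v` is **surjective** ("no global obstruction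
to leaving the local loci"), which gives `dim T = h¹_S(ad ρ) − Σ_v (h¹(K_v, ad ρ) − dim L_v)`.
In the Poitou–Tate / Greenberg–Wiles exact sequence
`0 → T → H¹(G_{K,S}, ad ρ) → ⊕_v H¹(K_v, ad ρ)/L_v → H¹_{L^⊥}(G_{K,S}, ad ρ(1))^∨ → H²(G_{K,S}, ad ρ)`
this surjectivity is *implied by* the vanishing of the dual Selmer group
`H¹_{L^⊥}(G_{K,S}, ad ρ(1))` (the separate request `DualTriangulineSelmer`), and is equivalent to
it iff `H¹_{L^⊥}(ad ρ(1))^∨ → H²(G_{K,S}, ad ρ)` is injective; the converse fails in general.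
[cite: MilneADT2006, Ch. I Th. 4.10], [cite: BellaicheChenevier2009, §7.6.1] -/
def FramedGaloisRep.TangentObstructionSurjective (S : Set (HeightOneSpectrum (𝓞 K)))
    (ρ : FramedGaloisRep K A n)
    (L : ∀ v : Sp, Submodule A ((FramedRep.adjoint (ρ.toLocal v.1)).H 1)) : Prop :=
  Function.Surjective (ρ.tangentObstructionMap S L)

/-- With no local condition imposed (`L_v = ⊤` for all `v`) the tangent–obstruction map is
trivially surjective and the tangent space is all of `H¹_S`. [folklore] -/
lemma FramedGaloisRep.tangentObstructionSurjective_top (S : Set (HeightOneSpectrum (𝓞 K)))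
    (ρ : FramedGaloisRep K A n) :
    ρ.TangentObstructionSurjective S (Sp := Sp) (fun _ => ⊤) := by
  intro y
  exact ⟨0, funext fun v => Subsingleton.elim _ _⟩

end GaloisAdjoint

/-! ### Parameters, framed lifts, change of framing -/

section Points

variable {G : Type*} [Group G] [TopologicalSpace G]

/-- `𝒯ⁿ(C)`: the `C`-points of the character variety `\widehat{(Fˣ)ⁿ}`, i.e. `n`-tuples
`δ = (δ₁, …, δₙ)` of continuous characters `δᵢ : Fˣ → Cˣ` (parameters of triangulations).
[cite: BreuilHellmannSchraen2017Trianguline, §2.2] -/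
abbrev CharacterTuple (F : Type*) [Field F] [TopologicalSpace F] (C : Type*) [CommRing C]
    [TopologicalSpace C] (n : ℕ) : Type _ :=
  Fin n → (Fˣ →ₜ* Cˣ)

variable {C : Type*} [Field C] [TopologicalSpace C] [IsTopologicalRing C]
  {k : Type*} [Field k] [TopologicalSpace k] {n : ℕ}

/-- `ρ : G →ₜ* GL_n(C)` is a **framed `O`-integral lift** of `ρ̄ : G →ₜ* GL_n(k)` along
`θ : O → k` (`O ⊆ C` a valuation subring): `ρ` takes values in `GL_n(O)` — say `ρ = ρ₀ ⊗_O C` —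
and `θ(ρ₀(g)) = ρ̄(g)` for all `g`, on the nose (no conjugation): a `C`-valued point of the framed
deformation space `Spf R^□_{ρ̄}` (the ring pro-representing triples `(V_A, ι, b)`: deformation plus
basis lifting the fixed basis of `ρ̄`).  "Reduction of `ρ₀` is `ρ̄`" has its intended meaning when
`ker θ` is the maximal ideal of `O`, i.e. `θ` factors through the residue field — automatic for the
intended rank-one cases `C = ℚ̄_p`, `O = 𝒪_{ℚ̄_p}` or `C = E/ℚ_p` finite, `O = 𝒪_E` (a ring map to
a field kills `p ∈ 𝔪_O`, and `𝔪_O` is the only prime containing `p`); for valuation subrings of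
higher rank add that hypothesis where the predicate is used.
[cite: BreuilHellmannSchraen2017Trianguline, §2.2], [cite: Mazur1997Deformation, §8] -/
def FramedRep.IsFramedLift (O : ValuationSubring C) (θ : O →+* k) (ρ : FramedRep G C n)
    (ρbar : FramedRep G k n) : Prop :=
  ∃ ρ₀ : G →* GL (Fin n) O,
    (∀ g, Matrix.GeneralLinearGroup.map O.subtype (ρ₀ g) = ρ g) ∧
      ∀ g, Matrix.GeneralLinearGroup.map θ (ρ₀ g) = ρbar g

/-- Conjugating by `1` does nothing.  (Private local copy of `FramedRep.conj_one` of
`Literature/NumberTheory/GaloisRepresentations/OrdinaryRegular.lean`, to avoid importing that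
file's local class field theory closure.) [folklore] -/
@[simp] private lemma FramedRep.conj_one_eq (ρ : FramedRep G C n) : ρ.conj 1 = ρ :=
  ContinuousMonoidHom.ext fun g => by simp

/-- Iterated change of framing: `Q (P ρ P⁻¹) Q⁻¹ = (QP) ρ (QP)⁻¹`.  (Private local copy of
`FramedRep.conj_conj` of `OrdinaryRegular.lean`, as for `conj_one_eq`.) [folklore] -/
private lemma FramedRep.conj_conj_eq (P Q : GL (Fin n) C) (ρ : FramedRep G C n) :
    (ρ.conj P).conj Q = ρ.conj (Q * P) :=
  ContinuousMonoidHom.ext fun g => by simp [mul_assoc]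

/-- Undoing a change of framing. [folklore] -/
lemma FramedRep.conj_inv_conj (P : GL (Fin n) C) (ρ : FramedRep G C n) :
    (ρ.conj P).conj P⁻¹ = ρ := by
  rw [FramedRep.conj_conj_eq, inv_mul_cancel, FramedRep.conj_one_eq]

/-- Characteristic polynomials are invariant under change of framing:
`det(X − P ρ(g) P⁻¹) = det(X − ρ(g))` (Mathlib `Matrix.charpoly_units_conj`). [folklore] -/
lemma FramedRep.charpoly_conj (P : GL (Fin n) C) (ρ : FramedRep G C n) (g : G) :
    (ρ.conj P).charpoly g = ρ.charpoly g := by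
  simp only [FramedRep.charpoly, FramedRep.conj_apply, Units.val_mul, Matrix.coe_units_inv]
  exact Matrix.charpoly_units_conj P _

end Points

/-! ### The global spaces `𝔛_{ρ̄,S}(C)` and `X^glob_tri(ρ̄,S)(C)` -/

section Global

variable {K : Type u} [Field K] [NumberField K] {C : Type v} [Field C] [TopologicalSpace C]
  [IsTopologicalRing C] {k : Type w} [Field k] [TopologicalSpace k] {n : ℕ}

/-- **Local input** at the places of `Sp`: for each `v ∈ Sp` a set of `C`-points `(r, δ)` with
`r : Γ_{K_v} →ₜ* GL_n(C)` and `δ ∈ 𝒯ⁿ(C)`.  Intended instance (request `TriangulineAt`): the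
`C`-points of the trianguline variety `X^□_tri(ρ̄|_{Γ_{K_v}}) ⊆ 𝔛^□ × 𝒯ⁿ`, or of its smooth
Zariski-open dense part `U^□_tri(ρ̄|_{Γ_{K_v}})^reg`.
[cite: BreuilHellmannSchraen2017Trianguline, Déf. 2.4] -/
abbrev LocalParameterLoci (K : Type u) [Field K] [NumberField K] (C : Type v) [Field C]
    [TopologicalSpace C] (n : ℕ) (Sp : Set (HeightOneSpectrum (𝓞 K))) : Type _ :=
  ∀ v : Sp, Set (FramedGaloisRep (v.1.adicCompletion K) C n × CharacterTuple (v.1.adicCompletion K) C n)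

variable {Sp : Set (HeightOneSpectrum (𝓞 K))}

namespace DeformationSpace

/-- A `C`-point of the *framed* global deformation space `𝔛^□_{ρ̄,S}`: a framed `O`-integral lift
`ρ : Γ_K →ₜ* GL_n(C)` of `ρ̄` along `θ` which is unramified at every finite place outside `S`.
[cite: BreuilHellmannSchraen2017Smoothness, §3.1], [cite: Mazur1997Deformation, §26] -/
structure FramedPoint (ρbar : ModPGaloisRep K k n) (S : Set (HeightOneSpectrum (𝓞 K)))
    (O : ValuationSubring C) (θ : O →+* k) where
  /-- The lift `ρ : Γ_K →ₜ* GL_n(C)`. -/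
  rep : FramedGaloisRep K C n
  /-- `ρ` is `O`-integral and reduces to `ρ̄` along `θ`, exactly. -/
  isFramedLift : FramedRep.IsFramedLift O θ rep ρbar
  /-- `ρ` is unramified outside `S`. -/
  isUnramifiedAt : ∀ v ∉ S, rep.IsUnramifiedAt v

variable {ρbar : ModPGaloisRep K k n} {S : Set (HeightOneSpectrum (𝓞 K))} {O : ValuationSubring C}
  {θ : O →+* k}

/-- Change of framing on `𝔛^□_{ρ̄,S}(C)`: `x ≈ y` iff `y.rep = P x.rep P⁻¹` for some
`P ∈ GL_n(C)`. [cite: Mazur1997Deformation, §8] -/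
instance setoid (ρbar : ModPGaloisRep K k n) (S : Set (HeightOneSpectrum (𝓞 K)))
    (O : ValuationSubring C) (θ : O →+* k) : Setoid (FramedPoint ρbar S O θ) where
  r x y := ∃ P : GL (Fin n) C, y.rep = x.rep.conj P
  iseqv :=
    { refl := fun x => ⟨1, (FramedRep.conj_one_eq x.rep).symm⟩
      symm := fun {x y} ⟨P, hP⟩ => ⟨P⁻¹, by rw [hP, FramedRep.conj_inv_conj]⟩
      trans := fun {x y z} ⟨P, hP⟩ ⟨Q, hQ⟩ => ⟨Q * P, by rw [hQ, hP, FramedRep.conj_conj_eq]⟩ }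

omit [NumberField K] in
/-- Unfolding lemma for the change-of-framing relation on `𝔛^□_{ρ̄,S}(C)`. [folklore] -/
lemma FramedPoint.equiv_iff (x y : FramedPoint ρbar S O θ) :
    x ≈ y ↔ ∃ P : GL (Fin n) C, y.rep = x.rep.conj P := Iff.rfl

/-- The `C`-points of the global deformation space `𝔛_{ρ̄,S} = (Spf R_{ρ̄,S})^rig`: framed points
modulo change of framing.  (For `ρ̄` absolutely irreducible and `O` henselian, two `O`-integral
framed lifts which are `GL_n(C)`-conjugate have the same trace, hence are `GL_n(O)`-conjugate by
the Carayol–Serre theorem [cite: Mazur1997Deformation, §6], and then differ by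
`Oˣ · ker(GL_n(O) → GL_n(k))` by Schur's lemma for `ρ̄`: so these are the `C`-valued points of the
unframed deformation ring.) [cite: BreuilHellmannSchraen2017Smoothness, §3.1] -/
def Point (ρbar : ModPGaloisRep K k n) (S : Set (HeightOneSpectrum (𝓞 K)))
    (O : ValuationSubring C) (θ : O →+* k) : Type _ :=
  Quotient (setoid ρbar S O θ)

/-- The characteristic polynomial `det(X − ρ(g)) ∈ C[X]` of a point of `𝔛_{ρ̄,S}(C)` at
`g ∈ Γ_K`: well defined on classes (`FramedRep.charpoly_conj`); these are the natural functions
(traces of Frobenius, …) on the deformation space. [cite: Mazur1997Deformation, §21] -/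
def Point.charpoly (x : Point ρbar S O θ) (g : absoluteGaloisGroup K) : Polynomial C :=
  Quotient.lift (fun y : FramedPoint ρbar S O θ => y.rep.charpoly g)
    (fun a b (h : a ≈ b) => by
      obtain ⟨P, hP⟩ := (FramedPoint.equiv_iff a b).mp h
      change a.rep.charpoly g = b.rep.charpoly g
      rw [hP, FramedRep.charpoly_conj]) x

omit [NumberField K] in
/-- `Point.charpoly` on the class of a framed point. [folklore] -/
@[simp] lemma Point.charpoly_mk (x : FramedPoint ρbar S O θ) (g : absoluteGaloisGroup K) :
    Point.charpoly (Quotient.mk (setoid ρbar S O θ) x) g = x.rep.charpoly g := rfl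

end DeformationSpace

namespace GlobalTriangulineSpace

/-- A `C`-point of the *framed* global trianguline space
`X^glob,□_tri(ρ̄, S) = 𝔛^□_{ρ̄,S} ×_{𝔛^□_{ρ̄_p}} ∏_{v ∈ Sp} Xtri_v`: a framed `O`-integral lift
`ρ : Γ_K →ₜ* GL_n(C)` of `ρ̄` unramified outside `S`, with parameters `δ_v ∈ 𝒯ⁿ(C)` such that
`(ρ|_{Γ_{K_v}}, δ_v)` lies in the local locus `Xtri v` for every `v ∈ Sp` (intended: `Sp = {v ∣ p}`,
`Xtri v = X^□_tri(ρ̄|_{Γ_{K_v}})(C)`).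
[cite: BreuilHellmannSchraen2017Smoothness, §3.1, (3.3)–(3.4)],
[cite: BreuilHellmannSchraen2017Trianguline, Déf. 2.4] -/
structure FramedPoint (ρbar : ModPGaloisRep K k n) (S : Set (HeightOneSpectrum (𝓞 K)))
    (O : ValuationSubring C) (θ : O →+* k) (Xtri : LocalParameterLoci K C n Sp) where
  /-- The global representation `ρ : Γ_K →ₜ* GL_n(C)`. -/
  rep : FramedGaloisRep K C n
  /-- The parameters `δ = (δ_v)_{v ∈ Sp}`, `δ_v ∈ 𝒯ⁿ(C)`. -/
  param : ∀ v : Sp, CharacterTuple (v.1.adicCompletion K) C n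
  /-- `ρ` is `O`-integral and reduces to `ρ̄` along `θ`, exactly. -/
  isFramedLift : FramedRep.IsFramedLift O θ rep ρbar
  /-- `ρ` is unramified outside `S`. -/
  isUnramifiedAt : ∀ v ∉ S, rep.IsUnramifiedAt v
  /-- `(ρ|_{Γ_{K_v}}, δ_v) ∈ Xtri_v` for every `v ∈ Sp`. -/
  mem_local : ∀ v : Sp, (rep.toLocal v.1, param v) ∈ Xtri v

variable {ρbar : ModPGaloisRep K k n} {S : Set (HeightOneSpectrum (𝓞 K))} {O : ValuationSubring C}
  {θ : O →+* k} {Xtri : LocalParameterLoci K C n Sp}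

/-- First projection of the fibre product, framed form: `X^glob,□_tri → 𝔛^□_{ρ̄,S}`, `(ρ, δ) ↦ ρ`.
[cite: BreuilHellmannSchraen2017Smoothness, §3.1] -/
def FramedPoint.toDeformation (x : FramedPoint ρbar S O θ Xtri) :
    DeformationSpace.FramedPoint ρbar S O θ :=
  ⟨x.rep, x.isFramedLift, x.isUnramifiedAt⟩

/-- Second projection of the fibre product at `v ∈ Sp`: `X^glob,□_tri → Xtri_v`,
`(ρ, δ) ↦ (ρ|_{Γ_{K_v}}, δ_v)`. [cite: BreuilHellmannSchraen2017Smoothness, §3.1, (3.4)] -/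
def FramedPoint.toLocal (x : FramedPoint ρbar S O θ Xtri) (v : Sp) : Xtri v :=
  ⟨(x.rep.toLocal v.1, x.param v), x.mem_local v⟩

omit [IsTopologicalRing C] in
/-- Unfolding lemma for `FramedPoint.toLocal`. [folklore] -/
@[simp] lemma FramedPoint.coe_toLocal (x : FramedPoint ρbar S O θ Xtri) (v : Sp) :
    (x.toLocal v : FramedGaloisRep (v.1.adicCompletion K) C n × CharacterTuple (v.1.adicCompletion K) C n)
      = (x.rep.toLocal v.1, x.param v) := rfl

/-- Shrinking the local loci: a point for `Xtri` is a point for any `Xtri' ⊇ Xtri` (e.g.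
`U^□_tri ⊆ X^□_tri`). [folklore] -/
def FramedPoint.ofLE {Xtri' : LocalParameterLoci K C n Sp} (h : ∀ v, Xtri v ⊆ Xtri' v)
    (x : FramedPoint ρbar S O θ Xtri) : FramedPoint ρbar S O θ Xtri' :=
  ⟨x.rep, x.param, x.isFramedLift, x.isUnramifiedAt, fun v => h v (x.mem_local v)⟩

/-- Change of framing on `X^glob,□_tri(C)`: `x ≈ y` iff the parameters agree and
`y.rep = P x.rep P⁻¹` for some `P ∈ GL_n(C)`. [cite: Mazur1997Deformation, §8] -/
instance setoid (ρbar : ModPGaloisRep K k n) (S : Set (HeightOneSpectrum (𝓞 K)))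
    (O : ValuationSubring C) (θ : O →+* k) (Xtri : LocalParameterLoci K C n Sp) :
    Setoid (FramedPoint ρbar S O θ Xtri) where
  r x y := x.param = y.param ∧ ∃ P : GL (Fin n) C, y.rep = x.rep.conj P
  iseqv :=
    { refl := fun x => ⟨rfl, 1, (FramedRep.conj_one_eq x.rep).symm⟩
      symm := fun {x y} ⟨h, P, hP⟩ => ⟨h.symm, P⁻¹, by rw [hP, FramedRep.conj_inv_conj]⟩
      trans := fun {x y z} ⟨h, P, hP⟩ ⟨h', Q, hQ⟩ =>
        ⟨h.trans h', Q * P, by rw [hQ, hP, FramedRep.conj_conj_eq]⟩ }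

/-- Unfolding lemma for the change-of-framing relation. [folklore] -/
lemma FramedPoint.equiv_iff (x y : FramedPoint ρbar S O θ Xtri) :
    x ≈ y ↔ x.param = y.param ∧ ∃ P : GL (Fin n) C, y.rep = x.rep.conj P := Iff.rfl

variable (ρbar S O θ Xtri) in
/-- The `C`-points of the **global trianguline space**
`X^glob_tri(ρ̄, S) = 𝔛_{ρ̄,S} ×_{𝔛^□_{ρ̄_p}} ∏_{v ∈ Sp} Xtri_v`: framed points modulo change of
framing.  With `Sp = {v ∣ p}` and `Xtri v` the trianguline variety of `ρ̄|_{Γ_{K_v}}` these are the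
pairs `(ρ, δ)`, `ρ` a lift of `ρ̄` unramified outside `S` up to conjugation, `δ ∈ 𝒯ⁿ_p`, with
`(ρ|_{Γ_{K_v}}, δ_v) ∈ X^□_tri(ρ̄_v)` for all `v ∣ p`.
[cite: BreuilHellmannSchraen2017Smoothness, §3.1, (3.3)–(3.4)],
[cite: BreuilHellmannSchraen2017Trianguline, Déf. 2.4] -/
def Point : Type _ :=
  Quotient (setoid ρbar S O θ Xtri)

/-- The class of a framed point. [folklore] -/
def FramedPoint.toPoint (x : FramedPoint ρbar S O θ Xtri) : Point ρbar S O θ Xtri :=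
  Quotient.mk _ x

/-- Every point has a framed representative. [folklore] -/
lemma FramedPoint.toPoint_surjective :
    Function.Surjective (FramedPoint.toPoint : FramedPoint ρbar S O θ Xtri → Point ρbar S O θ Xtri) :=
  Quotient.mk_surjective

/-- Two framed points define the same point iff they differ by a change of framing. [folklore] -/
lemma FramedPoint.toPoint_eq_toPoint_iff (x y : FramedPoint ρbar S O θ Xtri) :
    x.toPoint = y.toPoint ↔ x ≈ y :=
  Quotient.eq

/-- The parameter map `X^glob_tri(C) → 𝒯ⁿ(C)^{Sp}`, `(ρ, δ) ↦ δ` (well defined on classes).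
[cite: BreuilHellmannSchraen2017Trianguline, §2.2 (`ω'`)] -/
def Point.param (x : Point ρbar S O θ Xtri) : ∀ v : Sp, CharacterTuple (v.1.adicCompletion K) C n :=
  Quotient.lift FramedPoint.param (fun a b (h : a ≈ b) => ((FramedPoint.equiv_iff a b).mp h).1) x

/-- `Point.param` on the class of a framed point. [folklore] -/
@[simp] lemma FramedPoint.param_toPoint (x : FramedPoint ρbar S O θ Xtri) :
    x.toPoint.param = x.param := rfl

/-- First projection of the fibre product: `X^glob_tri(C) → 𝔛_{ρ̄,S}(C)`, `(ρ, δ) ↦ ρ`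
(compatible with change of framing on both sides).
[cite: BreuilHellmannSchraen2017Smoothness, §3.1] -/
def Point.toDeformation (x : Point ρbar S O θ Xtri) : DeformationSpace.Point ρbar S O θ :=
  Quotient.map FramedPoint.toDeformation
    (fun a b (h : a ≈ b) => (DeformationSpace.FramedPoint.equiv_iff _ _).mpr
      ((FramedPoint.equiv_iff a b).mp h).2) x

/-- `Point.toDeformation` on the class of a framed point. [folklore] -/
@[simp] lemma FramedPoint.toDeformation_toPoint (x : FramedPoint ρbar S O θ Xtri) :
    x.toPoint.toDeformation = Quotient.mk _ x.toDeformation := rfl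

/-- **`X^glob_tri ↪ 𝔛_{ρ̄,S} × 𝒯ⁿ_p`**: a point of the global trianguline space is determined
by its underlying deformation and its parameter (it *is* a subspace of the product).
[cite: BreuilHellmannSchraen2017Smoothness, §3.1] -/
theorem Point.toDeformation_param_injective :
    Function.Injective fun x : Point ρbar S O θ Xtri => (x.toDeformation, x.param) := by
  intro x y hxy
  induction x using Quotient.inductionOn with
  | h x =>
    induction y using Quotient.inductionOn with
    | h y =>
      simp only [Prod.mk.injEq] at hxy
      obtain ⟨h1, h2⟩ := hxy
      refine Quotient.sound ⟨h2, ?_⟩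
      exact Quotient.exact h1

omit [IsTopologicalRing C] in
/-- The fibre-product description of the image: a pair (framed deformation, parameter) comes
from a framed point of `X^glob_tri` iff its local components lie in the loci `Xtri_v`.
[cite: BreuilHellmannSchraen2017Smoothness, §3.1, (3.4)] -/
theorem FramedPoint.exists_iff (d : DeformationSpace.FramedPoint ρbar S O θ)
    (δ : ∀ v : Sp, CharacterTuple (v.1.adicCompletion K) C n) :
    (∃ x : FramedPoint ρbar S O θ Xtri, x.toDeformation = d ∧ x.param = δ) ↔
      ∀ v : Sp, (d.rep.toLocal v.1, δ v) ∈ Xtri v := by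
  constructor
  · rintro ⟨x, rfl, rfl⟩ v
    exact x.mem_local v
  · intro h
    exact ⟨⟨d.rep, δ, d.isFramedLift, d.isUnramifiedAt, h⟩, rfl, rfl⟩

/-- The characteristic polynomial `det(X − ρ_x(g)) ∈ C[X]` of a point `x` of `X^glob_tri(C)` at
`g ∈ Γ_K` (well defined on classes; factors through `Point.toDeformation`).
[cite: Mazur1997Deformation, §21] -/
def Point.charpoly (x : Point ρbar S O θ Xtri) (g : absoluteGaloisGroup K) : Polynomial C :=
  x.toDeformation.charpoly g

/-- `Point.charpoly` on the class of a framed point is the characteristic polynomial of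
`ρ(g)`. [folklore] -/
@[simp] lemma FramedPoint.charpoly_toPoint (x : FramedPoint ρbar S O θ Xtri)
    (g : absoluteGaloisGroup K) : x.toPoint.charpoly g = x.rep.charpoly g := rfl

/-- Shrinking the local loci on points: `X^glob` for `Xtri` maps to `X^glob` for any
`Xtri' ⊇ Xtri`. [folklore] -/
def Point.ofLE {Xtri' : LocalParameterLoci K C n Sp} (h : ∀ v, Xtri v ⊆ Xtri' v)
    (x : Point ρbar S O θ Xtri) : Point ρbar S O θ Xtri' :=
  Quotient.map (FramedPoint.ofLE h)
    (fun a b (hab : a ≈ b) => (FramedPoint.equiv_iff _ _).mpr ((FramedPoint.equiv_iff a b).mp hab)) x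

end GlobalTriangulineSpace

/-- The **global trianguline space** `X^glob_tri(ρ̄, S)(C)` (its `C`-points): abbreviation for
`GlobalTriangulineSpace.Point ρ̄ S O θ Xtri`, the fibre product
`𝔛_{ρ̄,S} ×_{𝔛^□_{ρ̄_p}} ∏_{v ∈ Sp} Xtri_v` at the level of `C`-points, to be fed with
`Sp = {v ∣ p}` and `Xtri v =` the trianguline variety of `ρ̄|_{Γ_{K_v}}` (request `TriangulineAt`).
See the module docstring for the tangent-space layer (`FramedGaloisRep.tangentSpaceWith`,
`FramedGaloisRep.tangentObstructionMap`, `FramedGaloisRep.TangentObstructionSurjective`).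
[cite: BreuilHellmannSchraen2017Smoothness, §3.1, (3.3)–(3.4)],
[cite: BreuilHellmannSchraen2017Trianguline, Déf. 2.4, Th. 2.6] -/
abbrev GlobalTriangulineSpace (ρbar : ModPGaloisRep K k n) (S : Set (HeightOneSpectrum (𝓞 K)))
    (O : ValuationSubring C) (θ : O →+* k) (Xtri : LocalParameterLoci K C n Sp) : Type _ :=
  GlobalTriangulineSpace.Point ρbar S O θ Xtri

end Global

end Literature.NumberTheory.GaloisRepresentations
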